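import Literature.Topology.FourManifolds.SurfaceGroupNielsenCoreSidesAux
import HarnessLib

/-!
# Nielsen's theorem, pillar CORE: sides of a double point — the fixation and its crossing edges

Topic `Literature/Topology/FourManifolds`.  Second part of layer F4b of the minimal-counterexample
form of Zieschang's homotopic shortening theorem (Zieschang–Vogt–Coldewey, LNM 835, proof of
Thm. 5.3.2 and Lemma 5.3.4: *"we make a fixation of the double point … the chain of extreme
letters cannot change sides"*), continuing `SurfaceGroupNielsenCoreSidesAux.lean`.  For a
configuration `κ` and a double point `a < b` of the closed path, the side `SideIn κ a b σ` of
a slot `σ` (defined in `SurfaceGroupNielsenCoreCuts.lean`) is computed in closed form under the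
separation hypothesis `hsep : ∀ j, ¬ (PortalAt a j ∧ PortalAt b j)` (no occurrence is a portal
at both cuts — the same-kernel case is treated separately, without `SideIn`):

* a slot of a non-portal occurrence lies on the side of its kernel (`sideIn_iff_inside`); a
  kernel slot is inside iff its position lies in `[a, b)` (`sideIn_iff_of_isKernelSlot` — the
  consistency of the fixation with the closed path); a tail slot of `j` is inside iff
  `a < Kend j ≤ b`, a head slot iff `a ≤ Kstart j < b`; the slots `(k, q)` of the portal at
  `a` are inside iff `slotAt k a ≤ q`, those of the portal at `b` iff `q < slotAt k b`;
* the side form of (P2) (no subloop separates a chain: a kernel slot and the far end of its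
  chain lie on the same side), from its positional form taken as the hypothesis `hP2`
  (discharged by the surgery argument of `SurfaceGroupNielsenCoreSeparation.lean`); a formal
  edge between two kernel slots on different sides is a separated chain of length two
  (`false_of_isKernelSlot_fpartner`);
* crossing edges: `FCross` is symmetric in the formal pair; **a cancelling edge crosses the
  fixation iff it lies in the spur of a cut junction** (`ccross_iff_of_isTailSlot`,
  `ccross_iff_of_isHeadSlot`); the crossing formal edges of a symbol both of whose occurrences
  are portals; Boolean (`decide`) forms for the parity count of
  `BinaryProductComponents.lean`.

Claim (A), the interval lemmas and the crossing formal edges of portal symbols are in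
`SurfaceGroupNielsenCoreSides.lean`.

## References

* H. Zieschang, E. Vogt, H.-D. Coldewey, *Surfaces and Planar Discontinuous Groups*, LNM 835
  (1980), proof of Thm. 5.3.2 and Lemma 5.3.4. [ZieschangVogtColdewey1980]
-/

noncomputable section

namespace Literature.Topology.FourManifolds

open Literature.GroupTheory.CombinatorialGroupTheory List
open Literature.GroupTheory.CombinatorialGroupTheory.CycFactors (fac cpred jc kernel closedPath
  CycNielsen IsSlot IsHeadSlot IsTailSlot IsKernelSlot IsPairing cpartner cget fpartner kpos chainEnd)

namespace SurfaceGroup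

namespace Config

variable {g : ℕ} {φ : surfaceGen g → SurfaceGroup g}

/-! ## Sides of slots -/

/-- **Slots of a non-portal occurrence lie on the side of its kernel.**
[cite: ZieschangVogtColdewey1980, proof of Thm. 5.3.2 (fixation)] -/
theorem sideIn_iff_inside (κ : Config φ) {a b : ℕ} {σ : ℕ × ℕ} (ha : ¬ κ.PortalAt a σ.1)
    (hb : ¬ κ.PortalAt b σ.1) : κ.SideIn a b σ ↔ κ.Inside a b σ.1 := by
  simp only [SideIn, ha, hb, false_and, or_false]

/-- **Consistency of the fixation with the closed path**: a kernel slot is on the inside iff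
its position lies in `[a, b)`. [cite: ZieschangVogtColdewey1980, proof of Thm. 5.3.2 (fixation)] -/
theorem sideIn_iff_of_isKernelSlot (κ : Config φ) {a b : ℕ} (hab : a < b)
    (hsep : ∀ j, ¬ (κ.PortalAt a j ∧ κ.PortalAt b j)) {σ : ℕ × ℕ} (hσ : IsKernelSlot κ.U σ) :
    κ.SideIn a b σ ↔ (a ≤ kpos κ.U σ ∧ kpos κ.U σ < b) := by
  obtain ⟨h1, h2, h3, h4⟩ := κ.kernelSlot_arith hσ
  have h5 := hsep σ.1
  unfold SideIn Inside PortalAt slotAt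
  unfold PortalAt at h5
  omega

/-- **Sides of the slots of the portal at `a`**: the slot `(k, q)` is inside iff it comes at or
after the cut, `slotAt k a ≤ q`. [cite: ZieschangVogtColdewey1980, proof of Thm. 5.3.2 (fixation)] -/
theorem sideIn_iff_of_portalAt_left (κ : Config φ) {a b : ℕ}
    (hsep : ∀ j, ¬ (κ.PortalAt a j ∧ κ.PortalAt b j)) {k : ℕ} (hpk : κ.PortalAt a k) (q : ℕ) :
    κ.SideIn a b (k, q) ↔ κ.slotAt k a ≤ q := by
  have hnb : ¬ κ.PortalAt b k := fun h => hsep k ⟨hpk, h⟩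
  have hni : ¬ κ.Inside a b k := fun h => κ.not_portalAt_left_of_inside h hpk
  simp only [SideIn, hni, hpk, hnb, true_and, false_and, false_or, or_false]

/-- **Sides of the slots of the portal at `b`**: the slot `(k, q)` is inside iff it comes
before the cut, `q < slotAt k b`. [cite: ZieschangVogtColdewey1980, proof of Thm. 5.3.2 (fixation)] -/
theorem sideIn_iff_of_portalAt_right (κ : Config φ) {a b : ℕ}
    (hsep : ∀ j, ¬ (κ.PortalAt a j ∧ κ.PortalAt b j)) {k : ℕ} (hpk : κ.PortalAt b k) (q : ℕ) :
    κ.SideIn a b (k, q) ↔ q < κ.slotAt k b := by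
  have hna : ¬ κ.PortalAt a k := fun h => hsep k ⟨h, hpk⟩
  have hni : ¬ κ.Inside a b k := fun h => κ.not_portalAt_right_of_inside h hpk
  simp only [SideIn, hni, hpk, hna, true_and, false_and, false_or]

/-! ## Formal edges -/

/-- `FCross` is symmetric in the formal pair. [folklore] -/
theorem fcross_fpartner_iff (κ : Config φ) {a b : ℕ} {σ : ℕ × ℕ} (hσ : IsSlot κ.U σ) :
    κ.FCross a b (fpartner κ.U κ.bar σ) ↔ κ.FCross a b σ := by
  unfold FCross
  rw [κ.isPairing_bar.fpartner_fpartner hσ]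
  exact not_congr Iff.comm

/-- The formal edges at the slots of `k̄`, read from the slots of `k`: the edge at `(k̄, q)` is
the edge at `(k, n - 1 - q)`. [folklore] -/
theorem fcross_bar_iff (κ : Config φ) {a b k q : ℕ} (hk : k < κ.w.length) (hq : q < (fac κ.U k).length) :
    κ.FCross a b (κ.bar k, q) ↔ κ.FCross a b (k, (fac κ.U k).length - 1 - q) := by
  have hkU : k < κ.U.length := by rw [length_U]; exact hk
  have hs : IsSlot κ.U (k, (fac κ.U k).length - 1 - q) := ⟨hkU, by dsimp only; omega⟩
  have e : fpartner κ.U κ.bar (k, (fac κ.U k).length - 1 - q) = (κ.bar k, q) :=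
    Prod.ext rfl (by dsimp only [CycFactors.fpartner]; omega)
  rw [← e, κ.fcross_fpartner_iff hs]

/-- `FCross` in Boolean form (for the crossing count of the parity argument). [folklore] -/
theorem fcross_iff_decide_ne (κ : Config φ) (a b : ℕ) (σ : ℕ × ℕ) :
    κ.FCross a b σ ↔ decide (κ.SideIn a b σ) ≠ decide (κ.SideIn a b (fpartner κ.U κ.bar σ)) := by
  unfold FCross
  rw [ne_eq, decide_eq_decide]

/-- **Crossing formal edges of a symbol both of whose occurrences are portals** (`k` at `a`,
`k̄` at `b`): the edge at `(k, q)` crosses iff exactly one of `slotAt k a ≤ q`,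
`n - 1 - q < slotAt k̄ b` holds. [cite: ZieschangVogtColdewey1980, Lemma 5.3.4] -/
theorem fcross_iff_of_portalAt_left_of_portalAt_right_bar (κ : Config φ) {a b : ℕ}
    (hsep : ∀ j, ¬ (κ.PortalAt a j ∧ κ.PortalAt b j)) {k : ℕ} (hpa : κ.PortalAt a k)
    (hpb : κ.PortalAt b (κ.bar k)) (q : ℕ) :
    κ.FCross a b (k, q) ↔
      ¬ (κ.slotAt k a ≤ q ↔ (fac κ.U k).length - 1 - q < κ.slotAt (κ.bar k) b) := by
  have e : fpartner κ.U κ.bar (k, q) = (κ.bar k, (fac κ.U k).length - 1 - q) := rfl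
  unfold FCross
  rw [κ.sideIn_iff_of_portalAt_left hsep hpa q, e, κ.sideIn_iff_of_portalAt_right hsep hpb]

/-! ## Cancelling edges -/

/-- A kernel slot has no cancelling edge, hence no crossing one. [folklore] -/
theorem not_ccross_of_isKernelSlot (κ : Config φ) {a b : ℕ} {σ : ℕ × ℕ} (hσ : IsKernelSlot κ.U σ) :
    ¬ κ.CCross a b σ := by
  rintro ⟨σ', h, -⟩
  rw [CycFactors.cpartner_of_isKernelSlot hσ] at h
  cases h

/-- The crossing cancelling edge of a cancelled slot, via the total cancelling partner `cget`.
[folklore] -/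
theorem ccross_iff_cget (κ : Config φ) {a b : ℕ} {σ : ℕ × ℕ} (hσ : IsSlot κ.U σ)
    (hk : ¬ IsKernelSlot κ.U σ) :
    κ.CCross a b σ ↔ ¬ (κ.SideIn a b σ ↔ κ.SideIn a b (cget κ.U σ)) := by
  unfold CCross
  rw [CycFactors.cpartner_eq_some_cget hσ hk]
  simp only [Option.some.injEq, exists_eq_left']

/-- `CCross` in Boolean form (for the crossing count of the parity argument). [folklore] -/
theorem ccross_iff_decide_ne (κ : Config φ) {a b : ℕ} {σ : ℕ × ℕ} (hσ : IsSlot κ.U σ)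
    (hk : ¬ IsKernelSlot κ.U σ) :
    κ.CCross a b σ ↔ decide (κ.SideIn a b σ) ≠ decide (κ.SideIn a b (cget κ.U σ)) := by
  rw [κ.ccross_iff_cget hσ hk, ne_eq, decide_eq_decide]

/-! ## A crossing formal edge between kernel slots is a separated chain -/

/-- **A formal edge between two kernel slots on different sides of the subloop contradicts
(P2)**: the chain through the first is `[σ, fpartner σ]`. [cite: ZieschangVogtColdewey1980, proof of Thm. 5.3.2] -/
theorem false_of_isKernelSlot_fpartner (κ : Config φ) {a b : ℕ}
    (hP2 : ∀ σ : ℕ × ℕ, IsKernelSlot κ.U σ → σ.1 < κ.w.length →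
      ((a ≤ kpos κ.U σ ∧ kpos κ.U σ < b) ↔
        (a ≤ kpos κ.U (chainEnd κ.U κ.bar σ) ∧ kpos κ.U (chainEnd κ.U κ.bar σ) < b)))
    {σ : ℕ × ℕ} (hσ : IsKernelSlot κ.U σ) (hτ : IsKernelSlot κ.U (fpartner κ.U κ.bar σ))
    (h : ¬ ((a ≤ kpos κ.U σ ∧ kpos κ.U σ < b) ↔
      (a ≤ kpos κ.U (fpartner κ.U κ.bar σ) ∧ kpos κ.U (fpartner κ.U κ.bar σ) < b))) : False := by
  have key := hP2 σ hσ (by rw [← length_U]; exact hσ.1.1)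
  rw [chainEnd_eq_fpartner hτ] at key
  exact h key

section Min

variable (κ : Config φ) (hg : 1 ≤ g) (hI : Indecomposable φ) (hM : MarkedNontrivial φ) (hmin : κ.IsMin)
include hg hI hM hmin

/-- **Sides of tail slots**: a tail slot of `j` is on the inside iff `a < Kend j ≤ b` (its
occurrence is inside, or is the portal at `a`). [cite: ZieschangVogtColdewey1980, proof of Thm. 5.3.2 (fixation)] -/
theorem sideIn_iff_of_isTailSlot {a b : ℕ} (hab : a < b)
    (hsep : ∀ j, ¬ (κ.PortalAt a j ∧ κ.PortalAt b j)) {σ : ℕ × ℕ} (hσ : IsTailSlot κ.U σ) :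
    κ.SideIn a b σ ↔ (a < κ.Kend σ.1 ∧ κ.Kend σ.1 ≤ b) := by
  obtain ⟨h1, -⟩ := κ.Kend_arith hg hI hM hmin σ.1
  have h2 := κ.Kstart_lt_Kend hg hI hM hmin σ.1
  have h3 := hσ.2
  have h4 := hσ.1.2
  have h5 := hsep σ.1
  unfold SideIn Inside PortalAt slotAt
  unfold PortalAt at h5
  omega

/-- **Sides of head slots**: a head slot of `j` is on the inside iff `a ≤ Kstart j < b` (its
occurrence is inside, or is the portal at `b`). [cite: ZieschangVogtColdewey1980, proof of Thm. 5.3.2 (fixation)] -/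
theorem sideIn_iff_of_isHeadSlot {a b : ℕ} (hab : a < b)
    (hsep : ∀ j, ¬ (κ.PortalAt a j ∧ κ.PortalAt b j)) {σ : ℕ × ℕ} (hσ : IsHeadSlot κ.U σ) :
    κ.SideIn a b σ ↔ (a ≤ κ.Kstart σ.1 ∧ κ.Kstart σ.1 < b) := by
  obtain ⟨h1, -⟩ := κ.Kend_arith hg hI hM hmin σ.1
  have h2 := κ.Kstart_lt_Kend hg hI hM hmin σ.1
  have h3 := hσ.2
  have h5 := hsep σ.1
  unfold SideIn Inside PortalAt slotAt
  unfold PortalAt at h5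
  omega

/-! ## (P2) in side form -/

/-- **(P2) in side form**: no subloop separates a chain — a kernel slot and the far end of its
chain lie on the same side; here derived from the positional form `hP2` (proved by surgery in
`SurfaceGroupNielsenCoreSeparation.lean`). [cite: ZieschangVogtColdewey1980, proof of Thm. 5.3.2 and 5.3.3] -/
theorem sideIn_iff_sideIn_chainEnd {a b : ℕ} (hab : a < b)
    (hsep : ∀ j, ¬ (κ.PortalAt a j ∧ κ.PortalAt b j))
    (hP2 : ∀ σ : ℕ × ℕ, IsKernelSlot κ.U σ → σ.1 < κ.w.length →
      ((a ≤ kpos κ.U σ ∧ kpos κ.U σ < b) ↔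
        (a ≤ kpos κ.U (chainEnd κ.U κ.bar σ) ∧ kpos κ.U (chainEnd κ.U κ.bar σ) < b)))
    {σ : ℕ × ℕ} (hσ : IsKernelSlot κ.U σ) :
    κ.SideIn a b σ ↔ κ.SideIn a b (chainEnd κ.U κ.bar σ) := by
  have hτ := CycFactors.isKernelSlot_chainEnd (κ.cycNielsen_U hg hI hM hmin) (κ.U_ne_nil hg)
    κ.isPairing_bar hσ
  rw [κ.sideIn_iff_of_isKernelSlot hab hsep hσ, κ.sideIn_iff_of_isKernelSlot hab hsep hτ]
  exact hP2 σ hσ (by rw [← length_U]; exact hσ.1.1)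

/-- (P2) in Boolean side form (the hypothesis of the mate lemma of the parity argument).
[cite: ZieschangVogtColdewey1980, proof of Thm. 5.3.2 and 5.3.3] -/
theorem decide_sideIn_eq_decide_sideIn_chainEnd {a b : ℕ} (hab : a < b)
    (hsep : ∀ j, ¬ (κ.PortalAt a j ∧ κ.PortalAt b j))
    (hP2 : ∀ σ : ℕ × ℕ, IsKernelSlot κ.U σ → σ.1 < κ.w.length →
      ((a ≤ kpos κ.U σ ∧ kpos κ.U σ < b) ↔
        (a ≤ kpos κ.U (chainEnd κ.U κ.bar σ) ∧ kpos κ.U (chainEnd κ.U κ.bar σ) < b)))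
    {σ : ℕ × ℕ} (hσ : IsKernelSlot κ.U σ) :
    decide (κ.SideIn a b σ) = decide (κ.SideIn a b (chainEnd κ.U κ.bar σ)) :=
  decide_eq_decide.2 (κ.sideIn_iff_sideIn_chainEnd hg hI hM hmin hab hsep hP2 hσ)

/-! ## Crossing cancelling edges -/

/-- **A cancelling pair crosses the fixation iff it lies in the spur of a cut junction**: for a
tail slot `τ` of `k₁` and a head slot `σ` of the cyclic successor `k₂`, the two lie on
different sides iff the junction `Kstart k₂` is one of the cuts.
[cite: ZieschangVogtColdewey1980, Lemma 5.3.4] -/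
theorem not_sideIn_iff_of_junction {a b : ℕ} (hab : a < b) (hbℓ : b < (closedPath κ.U).length)
    (hsep : ∀ j, ¬ (κ.PortalAt a j ∧ κ.PortalAt b j)) {τ σ : ℕ × ℕ} (hτ : IsTailSlot κ.U τ)
    (hσ : IsHeadSlot κ.U σ) (hk : σ.1 = (τ.1 + 1) % κ.w.length) :
    ¬ (κ.SideIn a b τ ↔ κ.SideIn a b σ) ↔ (κ.Kstart σ.1 = a ∨ κ.Kstart σ.1 = b) := by
  rw [κ.sideIn_iff_of_isTailSlot hg hI hM hmin hab hsep hτ,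
    κ.sideIn_iff_of_isHeadSlot hg hI hM hmin hab hsep hσ]
  have hm : τ.1 < κ.w.length := by rw [← length_U]; exact hτ.1.1
  rcases Nat.lt_or_ge (τ.1 + 1) κ.w.length with hlt | hge
  · rw [Nat.mod_eq_of_lt hlt] at hk
    rw [hk, Kstart_succ]
    omega
  · have he : τ.1 + 1 = κ.w.length := by omega
    rw [he, Nat.mod_self] at hk
    have h1 : κ.Kend τ.1 = (closedPath κ.U).length := by
      rw [← Kstart_succ, he, Kstart_length]
    rw [hk, Kstart_zero, h1]
    omega

/-- **Crossing cancelling edges, tail form**: the cancelling edge at a tail slot of `k` crosses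
iff the junction after `k` (position `Kstart ((k+1) mod m)`) is one of the two cuts.
[cite: ZieschangVogtColdewey1980, Lemma 5.3.4] -/
theorem ccross_iff_of_isTailSlot {a b : ℕ} (hab : a < b) (hbℓ : b < (closedPath κ.U).length)
    (hsep : ∀ j, ¬ (κ.PortalAt a j ∧ κ.PortalAt b j)) {σ : ℕ × ℕ} (hσ : IsTailSlot κ.U σ) :
    κ.CCross a b σ ↔
      (κ.Kstart ((σ.1 + 1) % κ.w.length) = a ∨ κ.Kstart ((σ.1 + 1) % κ.w.length) = b) := by
  have hh := hσ.isHeadSlot_cget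
  have h1 : (cget κ.U σ).1 = (σ.1 + 1) % κ.w.length := by
    rw [hσ.cget_eq, length_U]
  rw [κ.ccross_iff_cget hσ.1 (fun hk => hk.not_isTailSlot hσ),
    κ.not_sideIn_iff_of_junction hg hI hM hmin hab hbℓ hsep hσ hh h1, h1]

/-- **Crossing cancelling edges, head form**: the cancelling edge at a head slot of `k` crosses
iff the junction before `k` (position `Kstart k`) is one of the two cuts.
[cite: ZieschangVogtColdewey1980, Lemma 5.3.4] -/
theorem ccross_iff_of_isHeadSlot {a b : ℕ} (hab : a < b) (hbℓ : b < (closedPath κ.U).length)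
    (hsep : ∀ j, ¬ (κ.PortalAt a j ∧ κ.PortalAt b j)) {σ : ℕ × ℕ} (hσ : IsHeadSlot κ.U σ) :
    κ.CCross a b σ ↔ (κ.Kstart σ.1 = a ∨ κ.Kstart σ.1 = b) := by
  have hN := κ.cycNielsen_U hg hI hM hmin
  have hU := κ.U_ne_nil hg
  have ht := hσ.isTailSlot_cget hN hU
  have h1 : ((cget κ.U σ).1 + 1) % κ.w.length = σ.1 := by
    rw [hσ.cget_eq hN hU, ← length_U]
    exact CycFactors.cpred_mod_succ_mod hσ.1.1
  rw [κ.ccross_iff_cget hσ.1 (fun hk => hk.not_isHeadSlot hσ)]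
  exact (not_congr Iff.comm).trans (κ.not_sideIn_iff_of_junction hg hI hM hmin hab hbℓ hsep ht hσ h1.symm)

/-- **No crossing cancelling edge away from the cut junctions**: if neither cut is a junction
(both are portals) then no cancelling edge crosses. [cite: ZieschangVogtColdewey1980, Lemma 5.3.4] -/
theorem not_ccross_of_not_isJunction {a b : ℕ} (hab : a < b) (hbℓ : b < (closedPath κ.U).length)
    (hsep : ∀ j, ¬ (κ.PortalAt a j ∧ κ.PortalAt b j)) (ha : ¬ κ.IsJunction a) (hb : ¬ κ.IsJunction b)
    {σ : ℕ × ℕ} (hs : IsSlot κ.U σ) : ¬ κ.CCross a b σ := by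
  intro hc
  have hm : 0 < κ.w.length := by rw [← length_U]; exact Nat.zero_lt_of_lt hs.1
  rcases hs.trichotomy with hk | hh | ht
  · exact κ.not_ccross_of_isKernelSlot hk hc
  · have hσm : σ.1 < κ.w.length := by rw [← length_U]; exact hh.1.1
    rcases (κ.ccross_iff_of_isHeadSlot hg hI hM hmin hab hbℓ hsep hh).1 hc with h | h
    · exact ha ⟨σ.1, hσm, h⟩
    · exact hb ⟨σ.1, hσm, h⟩
  · rcases (κ.ccross_iff_of_isTailSlot hg hI hM hmin hab hbℓ hsep ht).1 hc with h | h
    · exact ha ⟨_, Nat.mod_lt _ hm, h⟩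
    · exact hb ⟨_, Nat.mod_lt _ hm, h⟩

end Min

end Config

end SurfaceGroup

end Literature.Topology.FourManifolds

end
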